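import Literature.AlgebraicGeometry.ShimuraVarieties.UnitaryShimuraCanonicalModelTower
import Literature.AlgebraicGeometry.ShimuraVarieties.UnitaryCanonicalDescentPredicates
import Literature.AlgebraicGeometry.ShimuraVarieties.UnitaryAuxiliaryReflexBookkeeping
import HarnessLib

/-!
# The tower lemma in the vocabulary of its consumers: `IsCanonicalDescentOver` and the reflex compositum `E♯`

Topic `AlgebraicGeometry/ShimuraVarieties`; namespace `Literature.AlgebraicGeometry.ShimuraVarieties`, grouping
sub-namespace `UnitaryCanonicalModel`.  THEOREMS ONLY (no definition, no named fact; nothing under `Summits/` is used;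
no binder of any cell is discharged; HC_CM is not mentioned).

`UnitaryShimuraCanonicalModelTower` proves the tower lemma with Shimura reciprocity (62) written out as a formula; the
predicate `UnitaryCanonicalModel.IsCanonicalDescentOver Sc ιE M e` (`UnitaryCanonicalDescentPredicates`) IS that formula
(definitionally), and the B-side of cell `hodgecm-mathlib` delivers its forms over the reflex compositum
`E♯ = τ(L)·E*(Φ) = Aux.reflexField L Φ τ ⊆ ℂ` (`UnitaryAuxiliaryHeckeQuotientDescent.galoisLegDescentOver_of_F1`:
`∃ M e', IsCanonicalDescentOver Sc (algebraMap ↥E♯ ℂ) M e'`).  This file restates the tower lemma in exactly these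
terms, so that the `∀ E ⊇ τ(L)·E*(Φ)` clause of the a1-consumer (`stub_reflexCompositumModel`) follows from ONE
`E♯`-form by name:

* `exists_isCanonicalDescentOver_of_range_subset` — `IsCanonicalDescentOver` over `E′` and `ιE′(E′) ⊆ ιE(E)` give
  `IsCanonicalDescentOver` over `E` (for the base change `M′ ⊗_{E′} E`);
* `forall_exists_isCanonicalDescentOver_of_reflexField` / `forall_exists_form_of_reflexField` — an `E♯`-form with
  `IsCanonicalDescentOver Sc (algebraMap ↥E♯ ℂ) M♯ e♯` gives, for EVERY field `E` with `τ(L) ⊆ ιE(E) ⊇ E*(Φ)`, an `E`-form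
  with reciprocity for `Aut(ℂ/E)` — worded with the predicate, resp. with the formula VERBATIM as in the consumer
  (`E♯ ⊆ ιE(E)` is the tree's `Aux.coe_reflexField_subset_range`, [Liu2021] App. C Lem. C.14).

## References
* [Deligne1971TravauxShimura] P. Deligne, *Travaux de Shimura* (1971), Déf. 3.13 (p. 141), Prop. 5.10 (p. 157).
* [Milne2005ShimuraVarieties] J. S. Milne, *Introduction to Shimura varieties* (2005/2017), Def. 12.8 (62) p. 114.
* [Liu2021] Y. Liu, *Fourier–Jacobi cycles and arithmetic relative trace formula* (2021), App. C Lem. C.14, Rem. C.15.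
-/

set_option autoImplicit false

noncomputable section

open Function MulAction NumberField IsDedekindDomain CategoryTheory CategoryTheory.Limits Matrix
  AlgebraicGeometry
open scoped Matrix ComplexOrder
open Literature.AlgebraicGeometry.Motives
open Literature.NumberTheory.Automorphic Literature.NumberTheory.Automorphic.UnitaryGroup
open Literature.NumberTheory.Automorphic.Liu2021.AppendixC (C5.OpenCompactSubgroup C5.SmallLevel)
open Literature.Geometry.ComplexHyperbolic Literature.Geometry.ComplexHyperbolic.BallModel
open Literature.NumberTheory.Automorphic.ShimuraDissection
open Literature.NumberTheory.ComplexMultiplication (traceField)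

namespace Literature.AlgebraicGeometry.ShimuraVarieties

namespace UnitaryCanonicalModel

variable {L : Type} [Field L] [NumberField L] [IsCMField L] {H : Matrix (Fin 3) (Fin 3) L} {τ : L →+* ℂ}
  {T : GL (Fin 3) ℂ} {hT : formCongr (starRingEnd ℂ) T (H.map τ) = BallModel.J}
  {K₀ : C5.OpenCompactSubgroup ↥(finAdelic (↥(maximalRealSubfield L)) L (IsCMField.complexConj L) 3 H)}

/-! ### §1. The tower lemma with the predicate `IsCanonicalDescentOver` -/

/-- **Tower lemma, predicate form.**  An `E′`-form `(M′, e′)` of the complex tower `Sc.Mc` with Shimura reciprocity (62)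
for `Aut(ℂ/ιE′ E′)` (`IsCanonicalDescentOver Sc ιE′ M′ e′`) and an inclusion of images `ιE′(E′) ⊆ ιE(E)` give an `E`-form
with reciprocity (62) for the smaller group `Aut(ℂ/ιE E)` — the base change `M′ ⊗_{E′} E` along the factorisation
`ιE′ = ιE ∘ j` (`exists_form_of_range_subset`; the predicate is the formula there, definitionally).
[cite: Deligne1971TravauxShimura, Déf. 3.13 p. 141 and Prop. 5.10 p. 157] [cite: Milne2005ShimuraVarieties, Def. 12.8 (62) p. 114] -/
theorem exists_isCanonicalDescentOver_of_range_subset (Sc : ComplexRecordSystem L H τ T hT K₀) {E E' : Type}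
    [Field E] [Field E'] (ιE : E →+* ℂ) (ιE' : E' →+* ℂ) (hEE : Set.range ιE' ⊆ Set.range ιE)
    (M' : C5.SmallLevel K₀ ⥤ SchemeOver E') (e' : (M' ⋙ baseChangeHom ιE') ≅ Sc.Mc)
    (h' : IsCanonicalDescentOver Sc ιE' M' e') :
    ∃ (M : C5.SmallLevel K₀ ⥤ SchemeOver E) (e : (M ⋙ baseChangeHom ιE) ≅ Sc.Mc), IsCanonicalDescentOver Sc ιE M e :=
  exists_form_of_range_subset Sc ιE ιE' hEE M' e' h'

/-! ### §2. From one form over the reflex compositum `E♯ = Aux.reflexField L Φ τ` to forms over every `E ⊇ τ(L)·E*(Φ)` -/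

omit [IsCMField L] in
/-- The image of `E♯ ⊆ ℂ` under its structure map to `ℂ` lies in `ιE(E)` as soon as `τ(L) ⊆ ιE(E) ⊇ E*(Φ)`
(`Aux.coe_reflexField_subset_range`: `E♯ = τ(L) ⊔ E*(Φ)` is the smallest such subfield). [cite: Liu2021, App. C Lem. C.14 (p. 113)] -/
theorem range_algebraMap_reflexField_subset (Φ : CMType L) (τ : L →+* ℂ) {E : Type} [Field E] [NumberField E]
    (ιE : E →+* ℂ) (hτ : Set.range τ ⊆ Set.range ιE) (hΦ : (traceField Φ : Set ℂ) ⊆ Set.range ιE) :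
    Set.range (algebraMap ↥(Aux.reflexField L Φ τ) ℂ) ⊆ Set.range ιE := by
  rintro _ ⟨x, rfl⟩
  exact Aux.coe_reflexField_subset_range Φ τ ιE hτ hΦ x.2

/-- **One `E♯`-form gives forms over every `E ⊇ τ(L)·E*(Φ)` (predicate form).**  If the complex tower `Sc.Mc` has a form
`(M♯, e♯)` over the reflex compositum `E♯ = Aux.reflexField L Φ τ ⊆ ℂ` with Shimura reciprocity (62) for `Aut(ℂ/E♯)`
(`IsCanonicalDescentOver Sc (algebraMap ↥E♯ ℂ) M♯ e♯` — the shape delivered by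
`HeckeQuotient.galoisLegDescentOver_of_F1`), then over EVERY field `E`, `ιE : E →+* ℂ`, with `τ(L) ⊆ ιE(E)` and
`E*(Φ) = traceField Φ ⊆ ιE(E)` it has an `E`-form with reciprocity (62) for `Aut(ℂ/ιE E)`: `E♯ ⊆ ιE(E)`
([Liu2021] Lem. C.14), then the tower lemma. [cite: Liu2021, App. C Lem. C.14 (p. 113)]
[cite: Deligne1971TravauxShimura, Déf. 3.13 p. 141 and Prop. 5.10 p. 157] -/
theorem forall_exists_isCanonicalDescentOver_of_reflexField (Φ : CMType L) (Sc : ComplexRecordSystem L H τ T hT K₀)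
    (M₁ : C5.SmallLevel K₀ ⥤ SchemeOver ↥(Aux.reflexField L Φ τ))
    (e₁ : (M₁ ⋙ Motives.baseChange ↥(Aux.reflexField L Φ τ) ℂ) ≅ Sc.Mc)
    (h₁ : IsCanonicalDescentOver Sc (algebraMap ↥(Aux.reflexField L Φ τ) ℂ) M₁ e₁) :
    ∀ (E : Type) [Field E] [NumberField E] (ιE : E →+* ℂ),
      Set.range τ ⊆ Set.range ιE → (traceField Φ : Set ℂ) ⊆ Set.range ιE →
      ∃ (M : C5.SmallLevel K₀ ⥤ SchemeOver E) (e : (M ⋙ baseChangeHom ιE) ≅ Sc.Mc), IsCanonicalDescentOver Sc ιE M e :=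
  fun _ _ _ ιE hτ hΦ =>
    exists_isCanonicalDescentOver_of_range_subset Sc ιE (algebraMap ↥(Aux.reflexField L Φ τ) ℂ)
      (range_algebraMap_reflexField_subset Φ τ ιE hτ hΦ) M₁ e₁ h₁

/-- **One `E♯`-form gives forms over every `E ⊇ τ(L)·E*(Φ)` (formula form = the `∀ E`-clause of the a1-consumer
`stub_reflexCompositumModel` VERBATIM).**  Same statement as `forall_exists_isCanonicalDescentOver_of_reflexField` with the
predicate unfolded: Shimura reciprocity (62) at the diagonal special pairs, `σ • [x, aK] = [x, r_x(s)·aK]` for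
`σ ∈ Aut(ℂ/ιE E)`, `art_L(s) = σ|L^{ab}`, read on `M_K(ℂ)` through `e` and `AlgPoints.baseChangeEquiv ιE`.
[cite: Liu2021, App. C Lem. C.14 (p. 113)] [cite: Milne2005ShimuraVarieties, Def. 12.8 (62) p. 114]
[cite: Deligne1971TravauxShimura, Déf. 3.13 p. 141 and Prop. 5.10 p. 157] -/
theorem forall_exists_form_of_reflexField (Φ : CMType L) (Sc : ComplexRecordSystem L H τ T hT K₀)
    (M₁ : C5.SmallLevel K₀ ⥤ SchemeOver ↥(Aux.reflexField L Φ τ))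
    (e₁ : (M₁ ⋙ Motives.baseChange ↥(Aux.reflexField L Φ τ) ℂ) ≅ Sc.Mc)
    (h₁ : IsCanonicalDescentOver Sc (algebraMap ↥(Aux.reflexField L Φ τ) ℂ) M₁ e₁) :
    ∀ (E : Type) [Field E] [NumberField E] (ιE : E →+* ℂ),
      Set.range τ ⊆ Set.range ιE → (traceField Φ : Set ℂ) ⊆ Set.range ιE →
      ∃ (M : C5.SmallLevel K₀ ⥤ SchemeOver E) (e : (M ⋙ baseChangeHom ιE) ≅ Sc.Mc),
        letI : Algebra E ℂ := ιE.toAlgebra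
        ∀ (K : C5.SmallLevel K₀) (σ : ℂ ≃ₐ[E] ℂ) (s : (FiniteAdeleRing (𝓞 L) L)ˣ),
          IsArtinCorrespondent L τ s σ.toRingEquiv →
          ∀ (v₃ : Fin 3 → L) (x : Ball), IsLinePoint L τ T v₃ x →
            ∀ d : finAdelic (↥(maximalRealSubfield L)) L (IsCMField.complexConj L) 3 H,
              IsDiagTwist L H v₃ (recipFactor L s) d →
              ∀ a : finAdelic (↥(maximalRealSubfield L)) L (IsCMField.complexConj L) 3 H,
                σ • (AlgPoints.baseChangeEquiv ιE (M.obj K)).symm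
                    (AlgPoints.map (e.inv.app K) ((Sc.pts K).symm (ShimuraSet.mk L H τ T hT K.1.1 x a))) =
                  (AlgPoints.baseChangeEquiv ιE (M.obj K)).symm
                    (AlgPoints.map (e.inv.app K)
                      ((Sc.pts K).symm (ShimuraSet.mk L H τ T hT K.1.1 x (d * a)))) :=
  fun _ _ _ ιE hτ hΦ =>
    exists_form_of_range_subset Sc ιE (algebraMap ↥(Aux.reflexField L Φ τ) ℂ)
      (range_algebraMap_reflexField_subset Φ τ ιE hτ hΦ) M₁ e₁ h₁

end UnitaryCanonicalModel

end Literature.AlgebraicGeometry.ShimuraVarieties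

end
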